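import Summits.Ventures.QEC.Census.BB.A1s_n162_k12_a0a80268.Data
import HarnessLib

/-!
# Census row `A1s_n162_k12_a0a80268` — Brouwer–Zimmermann block verdicts 18…22 of the `Z` side (459810 codeword visits; fast twin `bzZBlockF`, `decide +kernel`, tier KERNEL). Part 3/3.
-/

set_option Elab.async false

namespace Summit.Ventures.QEC.Census.A1s_n162_k12_a0a80268

/-- Block 18 of the `Z` side replays (91962 codeword visits; fast twin `bzZBlockF`, `decide +kernel`). -/
theorem blkZ_18 : A1s_n162_k12_a0a80268.cert.bzZBlockF A1s_n162_k12_a0a80268.bz 18 = true := by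
  decide +kernel

/-- Block 19 of the `Z` side replays (91962 codeword visits; fast twin `bzZBlockF`, `decide +kernel`). -/
theorem blkZ_19 : A1s_n162_k12_a0a80268.cert.bzZBlockF A1s_n162_k12_a0a80268.bz 19 = true := by
  decide +kernel

/-- Block 20 of the `Z` side replays (91962 codeword visits; fast twin `bzZBlockF`, `decide +kernel`). -/
theorem blkZ_20 : A1s_n162_k12_a0a80268.cert.bzZBlockF A1s_n162_k12_a0a80268.bz 20 = true := by
  decide +kernel

/-- Block 21 of the `Z` side replays (91962 codeword visits; fast twin `bzZBlockF`, `decide +kernel`). -/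
theorem blkZ_21 : A1s_n162_k12_a0a80268.cert.bzZBlockF A1s_n162_k12_a0a80268.bz 21 = true := by
  decide +kernel

/-- Block 22 of the `Z` side replays (91962 codeword visits; fast twin `bzZBlockF`, `decide +kernel`). -/
theorem blkZ_22 : A1s_n162_k12_a0a80268.cert.bzZBlockF A1s_n162_k12_a0a80268.bz 22 = true := by
  decide +kernel

end Summit.Ventures.QEC.Census.A1s_n162_k12_a0a80268
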